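/-
Copyright (c) 2026 the pub-hodgecm-mathlib formalisation cell (harness21).  Prover seat hodgecm-mathlib-LH4-p16 (g2), req620 Track A «(D-RAM) FOUR-FRAME» squad
(STAGE-1b, row (2) of the piece `f_{T₊}`, the (β₂) road (R-36); β₂ sub-dealer LH4-p04 (g9) (L-Σ-3C), lane-C hinge LH7-p10 (g2) `beta2ConesC`; the lane-C twin of
LH4-p19 (g2)'s (L-D♭) K3 «coordinates of the cell scalar»: MECH-K1 v1 §2 INTERMEDIATE cells), 2026-09-04.
-/
import Summits.HodgeConjecture.HodgeConjecture.Theorems.F0P3cDyRamRayScalarBoundaryTerm     -- ★ p862205 (this lineage): `trace_div_eq_main_add_boundary`; brings ★ DEFS `dualGen`, ★ p861637 `inv_add_map_inv_eq_map_pairing`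
import HarnessLib

/-!
# Crux `H413`, line LH4 «(D-RAM) FOUR-FRAME» — STAGE-1b, row (2), the (β₂) road (R-36), lane C: «THE AFFINE COORDINATE OF A ROW VERTEX» — the ray scalar of the vertex over
# `Λ` is `e₀ = jE(pw·(μ_a + μ_b·(R₀ + V·γ₀)))` with ONE doubly-fixed coordinate `V = V(Λ)`: the cell scalar `D₀` is `Θ`-fixed, its trace-normalised inverse `κ̂ = D₀⁻¹∕jE pw`
# runs on the affine line `κ₀ + jE(F)·ξ₀` (`Tr_ρ = 1` inside `K = Fix Θ`), and `Tr_ρ(α·κ̂)` is AFFINE along that line with slope `ξ₀·(α − ρα) ∈ jE(E)`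

Cell `hodgecm-mathlib` (D-0151), FLOOR 0, crux item H413 = `stmt-HodgeConjecture-24833`, route of record `HCCMUnconditional`; squad F0∕P3c∕LH4; lane
`--supports stmt-HodgeConjecture-24833 --as helper` (count-neutral; pays NO tier-0 row).  THEOREMS ONLY (no `def`, no instance, no notation, no `sorry`, default heartbeats);
★-only imports; states NO law; (β₂) stays a HYPOTHESIS.  DATUM-FREE two-field letters (`jE : E → M`, commuting involutions `ρ`, `Θ` with `Fix ρ = jE(E)`, `Θ ∘ jE = jE ∘ σ`);
no valuation enters except in §3's size of the slope.

WHY (MECH-K1 v1 `F0/P3c/LH4/LH4-p16/g2/MECH-K1.v1.LH4p16g2.md` §1–§2: on the row the label of a vertex is `χ(e_t)·χ(1 + η_F(Λ))` with `η ≈ (μ_b∕μ_a)·R(Λ)`,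
`R(Λ) := Tr_ρ(α D₀⁻¹)∕Tr_ρ(D₀⁻¹)`; the CLEAN and FLIP cells are ★ (p862581∕p862630∕p862706∕RowVertexLettersOfTokens); the INTERMEDIATE cells (`1 ≤ k ≤ 2d − 3`) need the
DISTRIBUTION of `R(Λ)` over the cell — LH4-p19 (g2)'s (L-D♭) programme for lane B: K1 ★ p862655 digit balance `Σ_V ω(α₁ + γ₁V) = 0`, K2 ★ p862758 literal halving, K3 coordinates
`s_Λ = T̂(â + b̂V)`, affine label ★-cand `ω(f) = ω(T̂)·ω(α₁ + γ₁V)`, K5 fibration, K6 assembly.)  THIS FILE is lane C's K3 — the coordinate `V(Λ)` and the affine form of the ray scalar,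
in LANE-FREE algebra (only `D₀ ∈ Fix Θ` is used, true in every lane since `Θh_M = h_M`):
* §1 `map_cellScalar_theta` — `Θ D₀ = D₀` for `D₀ = cc(α − ρα)·Θ(dualGen ρ Θ α cc h_M x₀)` (`Θ` an involution, `Θh_M = h_M`); `traceNormalised_letters` — with the glue letter
  `D₀⁻¹ + ρD₀⁻¹ = jE pw`, `pw ≠ 0`: `κ̂ := D₀⁻¹·(jE pw)⁻¹` has `κ̂ + ρκ̂ = 1` and `Θκ̂ = κ̂`.
* §2 THE AFFINE LINE: `map_sub_div_anti` — two elements of ρ-trace `1` differ by a ρ-ANTI element, so `(κ − κ₀)∕ξ₀` is ρ-fixed for any ρ-anti `ξ₀ ≠ 0`; `exists_doublyFixed_coord` —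
  if moreover `κ, κ₀, ξ₀ ∈ Fix Θ` the coordinate is doubly fixed, i.e. `κ = κ₀ + jE(V)·ξ₀` with `σV = V`; `trace_gen_mul_affine` — `Tr_ρ(α(κ₀ + jE(V)ξ₀)) = Tr_ρ(ακ₀) + jE(V)·ξ₀(α − ρα)`
  and `ξ₀(α − ρα)` is ρ-fixed (`= jE γ₀`).
* §3 HEAD `rayScalar_eq_affine` — with `μ = jE μ_a + jE μ_b·α`: `Tr_ρ(μ∕D₀) = jE(pw·(μ_a + μ_b·(R₀ + V·γ₀)))` where `jE R₀ = Tr_ρ(ακ₀)`, `jE γ₀ = ξ₀(α − ρα)`, `V = V(Λ)` the §2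
  coordinate of `κ̂(Λ)` — LH4-p19's `s_Λ = T̂(â + b̂V)` shape with `T̂ = pw`, `â = μ_a + μ_b R₀`, `b̂ = μ_b γ₀` (the reference pair `(κ₀, ξ₀)` chosen ONCE per place); `v_slope_eq` —
  `|jE γ₀| = |ξ₀|·|α − ρα|`.
WHAT IS NOT CLAIMED: the range and multiplicities of `V(Λ)` over a cell (K5: `x₀ ↦ ν x₀` moves `κ̂` by `N_Θ(ν)⁻¹`; the population predicate halves the digit fibres via «Θ-fixed units are
Θ-norms up to `c₀`»), the affine-sign dictionary `ω(f_Λ) = ω(T̂)·ω(α₁ + γ₁V)` (★-cand `…DiagonalCellAffineLabel`, d even), the digit balance (★ p862655), lanes A∕B (LH4-p19 (g2)).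
HONEST LABEL.  Count-neutral algebra; nothing printed is asserted; no census law is stated; `HC_CM` is proved only modulo the 7 printed citations (2 remaining named inputs: hLiu418 =
`stmt-HodgeConjecture-24832`, h413 = `stmt-HodgeConjecture-24833`) until rung 0 closes.
## References
* [Jacobowitz1962] R. Jacobowitz, *Hermitian forms over local fields*, Amer. J. Math. 84 (1962): §4 (dual lattices, gluing); [Serre1979] J.-P. Serre, *Local Fields*, GTM 67 (1979):
  Ch. III §6 Prop. 12, Ch. V §3 Cor. 3, Ch. XIV §2–§3 (norm residue symbol on `U^{(n)}`).
* [Rogawski1990] J. D. Rogawski, Ann. of Math. Stud. 123 (1990): §4.9 Prop. 4.9.1 (b) p. 55; [Kottwitz1986BaseChangeUnits] R. E. Kottwitz, Compositio Math. 60 (1986): §1 pp. 240–241.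
-/

set_option autoImplicit false

noncomputable section

namespace Summit.HodgeConjecture.HodgeConjecture.Cruxes.H413.F0P3cDyRamRowVertexAffineCoordinate

open scoped Valued WithZero
open WithZero
open Summit.HodgeConjecture.HodgeConjecture.Cruxes.H413.F0P3cDyRamToricCensusDefs
open Summit.HodgeConjecture.HodgeConjecture.Cruxes.H413.F0P3cDyRamRayScalarBoundaryTerm (trace_div_eq_main_add_boundary)

variable {E M : Type} [Field E] [Valued E ℤᵐ⁰] [Field M] [Valued M ℤᵐ⁰] {ρ Θ : M →+* M} {α : M}

/-! ## §1 The cell scalar is `Θ`-fixed; its trace-normalised inverse has `ρ`-trace `1` and is `Θ`-fixed -/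

omit [Valued E ℤᵐ⁰] [Valued M ℤᵐ⁰] [Field E] in
/-- **THE CELL SCALAR IS `Θ`-FIXED**: `D₀ = cc·(α − ρα)·Θ(dualGen ρ Θ α cc h_M x₀) = h_M·N_Θ(x₀·cc·(α − ρα))` lies in `K = Fix Θ` (`Θ` an involution, `Θh_M = h_M`) — in every lane.
[cite: Jacobowitz1962, §4] -/
theorem map_cellScalar_theta (hΘΘ : ∀ x, Θ (Θ x) = x) {hM : M} (hΘh : Θ hM = hM) (cc x₀ : M) :
    Θ (cc * (α - ρ α) * Θ (dualGen ρ Θ α cc hM x₀)) = cc * (α - ρ α) * Θ (dualGen ρ Θ α cc hM x₀) := by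
  rw [dualGen_def]
  simp only [map_mul, map_sub, hΘΘ, hΘh]
  ring

omit [Valued E ℤᵐ⁰] [Valued M ℤᵐ⁰] in
/-- **THE TRACE-NORMALISED INVERSE `κ̂ = D₀⁻¹·(jE pw)⁻¹`**: from the glue letter `D₀⁻¹ + ρD₀⁻¹ = jE pw` (`pw ≠ 0`; ★ p861637 `inv_add_map_inv_eq_map_pairing`), `ρ` fixing `jE(E)`,
`Θ(jE pw) = jE pw` (`pw` σ-fixed) and `ΘD₀ = D₀`: `κ̂ + ρκ̂ = 1` and `Θκ̂ = κ̂`. [cite: Jacobowitz1962, §4] -/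
theorem traceNormalised_letters (jE : E →+* M) (hρj : ∀ c, ρ (jE c) = jE c) {D₀ : M} {pw : E} (hTr : D₀⁻¹ + ρ D₀⁻¹ = jE pw) (hpw : pw ≠ 0)
    (hΘD : Θ D₀ = D₀) (hΘpw : Θ (jE pw) = jE pw) :
    D₀⁻¹ * (jE pw)⁻¹ + ρ (D₀⁻¹ * (jE pw)⁻¹) = 1 ∧ Θ (D₀⁻¹ * (jE pw)⁻¹) = D₀⁻¹ * (jE pw)⁻¹ := by
  have hj0 : jE pw ≠ 0 := (map_ne_zero jE).2 hpw
  refine ⟨?_, by rw [map_mul, map_inv₀, map_inv₀, hΘD, hΘpw]⟩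
  rw [map_mul, map_inv₀ ρ (jE pw), hρj, ← add_mul, hTr, mul_inv_cancel₀ hj0]

/-! ## §2 The affine line `{Tr_ρ = 1} ∩ Fix Θ = κ₀ + jE(F)·ξ₀` and the affinity of `κ ↦ Tr_ρ(α·κ)` along it -/

omit [Valued E ℤᵐ⁰] [Valued M ℤᵐ⁰] [Field E] in
/-- **TWO ELEMENTS OF TRACE `1` DIFFER BY AN ANTI ELEMENT**, so their quotient by a fixed anti `ξ₀ ≠ 0` is ρ-FIXED: `ρ((κ − κ₀)∕ξ₀) = (κ − κ₀)∕ξ₀`. [cite: Serre1979, Ch. III §6 Prop. 12] -/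
theorem map_sub_div_anti {κ κ₀ ξ₀ : M} (hκ : κ + ρ κ = 1) (hκ₀ : κ₀ + ρ κ₀ = 1) (hξ : ρ ξ₀ = -ξ₀) :
    ρ ((κ - κ₀) / ξ₀) = (κ - κ₀) / ξ₀ := by
  have h1 : ρ κ = 1 - κ := by linear_combination hκ
  have h2 : ρ κ₀ = 1 - κ₀ := by linear_combination hκ₀
  rw [map_div₀, map_sub, h1, h2, hξ, div_neg]
  ring

omit [Valued E ℤᵐ⁰] [Valued M ℤᵐ⁰] in
/-- **THE DOUBLY-FIXED COORDINATE**: if `κ, κ₀ ∈ Fix Θ` have ρ-trace `1` and `ξ₀ ∈ Fix Θ` is ρ-anti and non-zero, then `κ = κ₀ + jE(V)·ξ₀` for a (unique) `V ∈ E` with `σ V = V`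
(`Fix ρ = jE(E)`, `Θ ∘ jE = jE ∘ σ`, `jE` injective). [cite: Serre1979, Ch. III §6 Prop. 12] -/
theorem exists_doublyFixed_coord {σ : E →+* E} (jE : E →+* M) (hjfix : ∀ z, ρ z = z ↔ ∃ c, jE c = z) (hΘj : ∀ c, Θ (jE c) = jE (σ c))
    {κ κ₀ ξ₀ : M} (hκ : κ + ρ κ = 1) (hκ₀ : κ₀ + ρ κ₀ = 1) (hξ : ρ ξ₀ = -ξ₀) (hξ0 : ξ₀ ≠ 0)
    (hΘκ : Θ κ = κ) (hΘκ₀ : Θ κ₀ = κ₀) (hΘξ : Θ ξ₀ = ξ₀) :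
    ∃ V : E, σ V = V ∧ κ = κ₀ + jE V * ξ₀ := by
  obtain ⟨V, hV⟩ := (hjfix ((κ - κ₀) / ξ₀)).1 (map_sub_div_anti hκ hκ₀ hξ)
  refine ⟨V, ?_, by rw [hV, div_mul_cancel₀ _ hξ0]; ring⟩
  have hΘ : Θ ((κ - κ₀) / ξ₀) = (κ - κ₀) / ξ₀ := by rw [map_div₀, map_sub, hΘκ, hΘκ₀, hΘξ]
  rw [← hV, hΘj] at hΘ
  exact jE.injective hΘ

omit [Valued E ℤᵐ⁰] [Valued M ℤᵐ⁰] [Field E] in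
/-- **`Tr_ρ(α·κ)` IS AFFINE ALONG THE LINE**: for `ρ` an involution, `ρW = W` and `ρξ₀ = −ξ₀`, `Tr_ρ(α(κ₀ + Wξ₀)) = Tr_ρ(ακ₀) + W·(ξ₀·(α − ρα))`, and the slope `ξ₀(α − ρα)` is
ρ-fixed. [cite: Serre1979, Ch. III §6 Prop. 12] -/
theorem trace_gen_mul_affine (hρρ : ∀ x, ρ (ρ x) = x) {κ₀ ξ₀ W : M} (hW : ρ W = W) (hξ : ρ ξ₀ = -ξ₀) :
    α * (κ₀ + W * ξ₀) + ρ (α * (κ₀ + W * ξ₀)) = (α * κ₀ + ρ (α * κ₀)) + W * (ξ₀ * (α - ρ α)) ∧ ρ (ξ₀ * (α - ρ α)) = ξ₀ * (α - ρ α) := by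
  refine ⟨?_, ?_⟩
  · simp only [map_mul, map_add, hW, hξ]; ring
  · rw [map_mul, map_sub, hξ, hρρ]; ring

/-! ## §3 HEAD — the ray scalar is affine in the coordinate: `Tr_ρ(μ∕D₀) = jE(pw·(μ_a + μ_b·(R₀ + V·γ₀)))` -/

omit [Valued E ℤᵐ⁰] [Valued M ℤᵐ⁰] in
/-- **THE COORDINATE OF A VERTEX**: with the glue letter `D₀⁻¹ + ρD₀⁻¹ = jE pw` (`pw ≠ 0`, `σpw = pw`), `ΘD₀ = D₀` (§1), and a reference pair `κ₀, ξ₀ ∈ Fix Θ` (`Tr_ρ κ₀ = 1`,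
`ξ₀` ρ-anti, non-zero) chosen once per place: `D₀⁻¹·(jE pw)⁻¹ = κ₀ + jE(V)·ξ₀` for some `σ`-fixed `V = V(Λ)`. [cite: Jacobowitz1962, §4] [cite: Serre1979, Ch. III §6 Prop. 12] -/
theorem exists_coord_of_vertex {σ : E →+* E} (jE : E →+* M) (hjfix : ∀ z, ρ z = z ↔ ∃ c, jE c = z) (hΘj : ∀ c, Θ (jE c) = jE (σ c))
    {D₀ : M} {pw : E} (hTr : D₀⁻¹ + ρ D₀⁻¹ = jE pw) (hpw : pw ≠ 0) (hσpw : σ pw = pw) (hΘD : Θ D₀ = D₀)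
    {κ₀ ξ₀ : M} (hκ₀ : κ₀ + ρ κ₀ = 1) (hξ : ρ ξ₀ = -ξ₀) (hξ0 : ξ₀ ≠ 0) (hΘκ₀ : Θ κ₀ = κ₀) (hΘξ : Θ ξ₀ = ξ₀) :
    ∃ V : E, σ V = V ∧ D₀⁻¹ * (jE pw)⁻¹ = κ₀ + jE V * ξ₀ := by
  have hρj : ∀ c : E, ρ (jE c) = jE c := fun c => (hjfix _).2 ⟨c, rfl⟩
  obtain ⟨hκ, hΘκ⟩ := traceNormalised_letters (Θ := Θ) jE hρj hTr hpw hΘD (by rw [hΘj, hσpw])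
  exact exists_doublyFixed_coord jE hjfix hΘj hκ hκ₀ hξ hξ0 hΘκ hΘκ₀ hΘξ

omit [Valued E ℤᵐ⁰] [Valued M ℤᵐ⁰] in
/-- **HEAD — «THE RAY SCALAR OF A ROW VERTEX IS AFFINE IN ITS COORDINATE».**  With `μ = jE μ_a + jE μ_b·α`, the glue letter `D₀⁻¹ + ρD₀⁻¹ = jE pw` (`pw ≠ 0`), the coordinate
`D₀⁻¹·(jE pw)⁻¹ = κ₀ + jE(V)·ξ₀` (`Tr_ρ κ₀ = 1`, `ρξ₀ = −ξ₀`, `σV = V`) and the two reference scalars `jE R₀ = Tr_ρ(α·κ₀)`, `jE γ₀ = ξ₀·(α − ρα)`: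
`Tr_ρ(μ∕D₀) = jE(pw·(μ_a + μ_b·(R₀ + V·γ₀)))` — LH4-p19 (g2)'s shape `s_Λ = T̂·(â + b̂·V)` with `T̂ = pw`, `â = μ_a + μ_b R₀`, `b̂ = μ_b γ₀`, so on the populated part (`ω(pw·…)` constant)
the label of the vertex is the AFFINE SIGN of the digit `V(Λ)` (MECH-K1 v1 §1: `label = χ(e)·χ(1 + η_F)`, `η = (μ_b∕μ_a)(R₀ + Vγ₀)` up to `|ϖ|^{2d−1}`).
[cite: Jacobowitz1962, §4] [cite: Kottwitz1986BaseChangeUnits, §1 pp. 240–241] [cite: Rogawski1990, §4.9 Prop. 4.9.1 (b) p. 55] [cite: Serre1979, Ch. XIV §2–§3] -/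
theorem rayScalar_eq_affine (jE : E →+* M) (hρj : ∀ c, ρ (jE c) = jE c) (hρρ : ∀ x, ρ (ρ x) = x)
    {D₀ : M} {pw : E} (hTr : D₀⁻¹ + ρ D₀⁻¹ = jE pw) (hpw : pw ≠ 0)
    {κ₀ ξ₀ : M} (hξ : ρ ξ₀ = -ξ₀) {V : E} (hσVρ : ρ (jE V) = jE V) (hκ : D₀⁻¹ * (jE pw)⁻¹ = κ₀ + jE V * ξ₀)
    {R₀ γ₀ : E} (hR₀ : jE R₀ = α * κ₀ + ρ (α * κ₀)) (hγ₀ : jE γ₀ = ξ₀ * (α - ρ α)) (μa μb : E) :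
    (jE μa + jE μb * α) / D₀ + ρ ((jE μa + jE μb * α) / D₀) = jE (pw * (μa + μb * (R₀ + V * γ₀))) := by
  have hj0 : jE pw ≠ 0 := (map_ne_zero jE).2 hpw
  have hinv : D₀⁻¹ = (κ₀ + jE V * ξ₀) * jE pw := by rw [← hκ, inv_mul_cancel_right₀ hj0]
  have haff := (trace_gen_mul_affine (α := α) hρρ (κ₀ := κ₀) hσVρ hξ).1
  have hτ : α * D₀⁻¹ + ρ (α * D₀⁻¹) = jE (pw * (R₀ + V * γ₀)) := by
    rw [hinv, show α * ((κ₀ + jE V * ξ₀) * jE pw) = jE pw * (α * (κ₀ + jE V * ξ₀)) by ring, map_mul ρ, hρj, ← mul_add, haff, ← hR₀, ← hγ₀]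
    simp only [map_mul, map_add]
  rw [trace_div_eq_main_add_boundary jE hρj D₀ hTr μa μb, hτ]
  simp only [map_mul, map_add]
  ring

omit [Valued E ℤᵐ⁰] in
/-- **THE SIZE OF THE SLOPE**: `|jE γ₀| = |ξ₀|·|α − ρα|` — in lane C `|α − ρα| = |ϖM|^{dρ}`, so the digit `V` enters `η` at depth `v(μ_b∕μ_a) + v(ξ₀) + dρ`; the reference anti
`ξ₀` may be taken with `|ξ₀|` the smallest value on `K ∩ {ρ-anti}` compatible with the cell (K5's choice). [cite: Serre1979, Ch. III §6 Prop. 12] -/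
theorem v_slope_eq {ξ₀ : M} {γ₀ : E} (jE : E →+* M) (hγ₀ : jE γ₀ = ξ₀ * (α - ρ α)) :
    Valued.v (jE γ₀) = Valued.v ξ₀ * Valued.v (α - ρ α) := by
  rw [hγ₀, Valuation.map_mul]

end Summit.HodgeConjecture.HodgeConjecture.Cruxes.H413.F0P3cDyRamRowVertexAffineCoordinate

end
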